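import Literature.MathematicalPhysics.QuantumFieldTheory.Balaban1983to89.B9PerturbationMajorant2Letters
import Literature.MathematicalPhysics.QuantumFieldTheory.Balaban1983to89.B9PerturbationL2Delta2
import Literature.MathematicalPhysics.QuantumFieldTheory.Balaban1983to89.B9Thm313WholeHolderProducersAtPinsPrint

/-!
# `Balaban1983to89.B9Thm313WholeDelta2LettersAtPinsPrint` — [B9] (3.135)∕(3.137) AT node00-def-Y's PINNED MODELS, PRINT'S TWO ROUTES: the TWO-SIDED split of the
# Δ⁽²⁾_π model `T2coK` (inner letters sup ∕ INTO the (P2′) class from ONE (3.43) member), and the ONE-SIDED letters T_a₂, T_b₂ FROM A REGULAR SOURCE carrying the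
# (3.44) member of the sandwich D_UG′D\*_U — the honest forms of the certificate's `hta₂` and `Letters3131H.tb₂H` (LOCATED-U8)

T. Bałaban, *Propagators for lattice gauge theories in a background field*, Commun. Math. Phys. **99** (1985) 389–434 [`Balaban1985BackgroundPropagators`,
"B9"]; [4] = T. Bałaban, *Propagators and renormalization transformations for lattice gauge theories. II*, Commun. Math. Phys. **96** (1984) 223–250
[`Balaban1984PropagatorsII`].  statement-level skeleton of published theorems with citation tags; proofs where landed; nothing here is a claim about
the Yang–Mills mass gap.  Sequel of `B9PerturbationMajorant2Letters` (generic letters) and `B9SmoothHolderClassPProducers` (g25 Hölder engine); uses dag-n06-w8's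
`B9PerturbationL2Delta2.t2coK_phys_eq_sandwich` (`T2coK … (GpPhysY) = (1 − D∘R∘G∘D\*) ∘ D2coK ∘ (1 − D∘G∘R∘D\*)`, all letters at `GpY`, no units factor).

THE PRINT.  (3.135) p. 422: *"Δ⁽²⁾_π = Δ⁽²⁾ − DRG′D\*Δ⁽²⁾ − Δ⁽²⁾DG′RD\* + DRG′D\*Δ⁽²⁾DG′RD\*"*; (3.137) p. 423; p. 423: *"we have derivatives in the operator Δ′_π + Δ⁽²⁾_π which have
to be applied either to the operator on the right, or on the left, because kernels … are not regular enough"*; (3.44) p. 398; Thm 3.1 (3.42)–(3.43) pp. 397–398; (3.49) p. 399.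

THE POINT (dag-n06-l LOCATED-U8, cell bus l.45635, HOME `DELTA2-LETTERS-MEMO.md`).  The N06 certificate (dag-n06-d editions ≥ 19) DISPLAYS the Δ⁽²⁾ content of
rows 20–21 as four composite sup letters `hta₂ ∕ hta₂R ∕ htb₂ ∕ htb₂R` on the RAW class 𝔠⁽²⁾, each containing the order-zero sandwich D_UG′D\*_U on a raw sup input —
not a printed species ((3.44) needs a Hölder input).  Print either moves the outer derivatives of (3.135) to the neighbouring G₀'s (the TWO-SIDED split
Δ⁽²⁾_π = M + D_U∘X + Y∘D\*_U + D_U∘Z∘D\*_U, M = Δ⁽²⁾, X = −RG′D\*_UM, Y = −MD_UG′R, Z = RG′D\*_U·M·D_UG′R — §1–§3) or feeds the sandwich a REGULAR input (the state of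
the (3.138) induction carries the Hölder sizes of G₀-outputs, (3.43); then (3.44) for G′ — §4, the route of record for the certificate, memo §5).  THIS FILE, at
node00-def-Y's pinned models: §1 ★ `t2coK_phys_eq_split4` (def-Y's `T2coK … (GpPhysY) Δ2 U` = `D2coK + DvcoKH ∘ X₂ + Y₂ ∘ DvscoKH + DvcoKH ∘ Z₂ ∘ DvscoKH`, explicit words over
the knit's letters at `GpY`), `t2_split4_of_pins`; §2 ★★ the SUP letters `m_of_hD2 ∕ x2_ ∕ y2_ ∕ z2_of_letters_phys` from `hD2sup h31 h49`; §3 ★★ `x2H_ ∕ z2H_pins_print_of_h43`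
(X₂, Z₂ INTO the (P2′) class `bHZPG (taxiS U) w` from ONE (3.43) member `h43`, dag-n06-l g25 engine); §4 ★ `ta2LcoK_phys_eq_comp`, ★★★ `ta2_pins_of_h44` — THE HONEST
`hta₂`: `Ta2LcoK … : b₁ → cNorm blk 0` from ANY source class `b₁` with a sup reading and the (3.44) member of `DvcoKH∘GcoS(GpY)∘DvscoKH` at dimension 2 (the certificate's
`h44G` species) —, ★★★ `tb₂H_pins_of_h43_of_src` — THE HONEST `Letters3131H.tb₂H` from the same source (no `hta₂` input; successor of p690516's `tb₂H_pins_print_of_h43`).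
HONEST SCOPE.  Kernel-checked bookkeeping over landed objects; Theorem 3.1 ((3.42)–(3.44)), (3.49), (3.137), the member facts are HYPOTHESES (nothing of [B9]∕[4] asserted);
constants ours, not optimised; no pin or certificate edited; COUNT-NEUTRAL; N06 NOT discharged; nothing continuum ∕ OS ∕ mass gap.  Cell `pub-ymgap` (HUMAN RULING D-0062),
Track A node N06 [B9], bundle F7 rows 20–21, seat `pub-ymgap-dag-n06-l` (g26), 2026-08-29.  NEW file; imports letters BY NAME; declares nothing in `Node00.*`.
-/

noncomputable section

namespace Literature.MathematicalPhysics.QuantumFieldTheory.Balaban1983to89.B9Thm313WholeDelta2LettersAtPinsPrint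

open B6Geom246MultiLevelTorus (geomT)
open B6GlobalChartV1 (PV blkV1)
open B6Ineq2142KLevelV1 (β lvl)
open B6KLevelCensusIndexV1 (KIdx)
open B6Prop22KLevelTorusCensusEta (nKT)
open B9GeoNormsKLevelV1 (geo9K)
open B9Thm34Ext (toB6)
open B9Thm39ReadingCoords (cR39)
open B9Thm312Whole (Ops GeoOK cNorm)
open B9Thm312WholeClasses (cNormR hasMaj_toR)
open B9RWSums343to347Whole (Facts347)
open B6RandomWalk (HasMajorant)
open B11SectG (BlockNorm HasMaj RowSum)
open B9CoReadingCoords (XBK blkBK)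
open B9CoReadingCoordsS (XSK sIK blkSK GcoS)
open B9GradViaDivLettersTransported (taxiS)
open B9SmoothHolderClassP (bHZPG)
open B9SmoothHolderClassPProducers (CTel hasMaj_src_ofR hasMaj_src_toR hasMaj_R_GpDvs_comp_into_bHZPG)
open B9PerturbationMajorantAlgebra (Thm31GpMaj Proj349Maj constA)
open B9PerturbationMajorant2Letters (maj_M maj_M_R maj_X2 maj_Y2 maj_Y2_R maj_Z2 maj_ta2_of_src hasMaj_tgt_ofR)
open B9PerturbationMajorantsAtLetters (PcoK rcoK_eq)
open B9PerturbationL2Delta2 (D2coK t2coK_phys_eq_sandwich)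
open B9PerturbationSplitAtLetters (Ta2LY Ta2LcoK Tb2LcoKH)
open B9Thm313WholeHolderProducersAtPinsPrint (tb2LcoKH_phys_eq_compTa2)
open B9Eq3132SectDLetters (gaugePiY)
open B9Ineq349SiteComposite (etaS_pos)
open Node00 (FBondY IBondY CfgY toKT SiteParY BondOpY GpY GpPhysY GpPhysY_apply RY_GpPhysY etaS gradY divY RY)
open Node00.OpsYSectDCoords (T2coK DvcoKH DvscoKH RcoK coordOpK_const_sub coordOpK_id coordOpK_smul coordOpK_const_comp coordOpK_const_comp_coordOpKH_const
  coordOpKH_const_comp_coordOpKH_const coordOpKH_eq_coordOpK)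
open B9CoReadingCoords (coordOpK)
open T4RelativeLadder (UnitaryLike)

variable {𝔸 : Type} [NormedRing 𝔸] [NormedAlgebra ℂ 𝔸] [CompleteSpace 𝔸] [FiniteDimensional ℝ 𝔸]
variable {κ : Type} [Fintype κ]
variable {d ℓ : ℕ} {hd : 1 ≤ d + 1} {hL : Odd (ℓ + 1) ∧ 1 < ℓ + 1} {b₀ b₁ : ℝ} (i : KIdx d ℓ hd hL b₀ b₁)
  (b : Module.Basis κ ℝ 𝔸) (B : B9.Backgrounds) (cfg : B.Cfg → CfgY 𝔸 i) (parS : SiteParY 𝔸 i) (Δ2 : BondOpY 𝔸 i)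

/-! ## §1 The two-sided split of def-Y's Δ⁽²⁾_π model at the print-units letter -/

section Split

/-- ★ **THE TWO-SIDED SPLIT (3.135) AT THE PINNED MODELS**: `T2coK … (GpPhysY) Δ2 U = D2coK + DvcoKH ∘ X₂ + Y₂ ∘ DvscoKH + DvcoKH ∘ Z₂ ∘ DvscoKH` with
`X₂ = −(R∘G∘D\*∘Δ⁽²⁾)`, `Y₂ = −(Δ⁽²⁾∘D∘G∘R)`, `Z₂ = R∘G∘D\*∘Δ⁽²⁾∘D∘G∘R` over the knit's letter models at `GpY` — the leading gauge-mode derivative LEFT of X₂, Z₂ and the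
trailing adjoint derivative RIGHT of Y₂, Z₂ (print p. 423: «applied either to the operator on the right, or on the left»).
[cite: Balaban1985BackgroundPropagators, (3.135) p.422, p.423, (3.25) p.394] -/
theorem t2coK_phys_eq_split4 (hc : cR39 b ≠ 0) (U₁ : B.Cfg) :
    T2coK i b B cfg parS (GpPhysY i parS) Δ2 U₁ =
      D2coK i b B cfg Δ2 U₁ +
      DvcoKH i b B cfg U₁ ∘ₗ
        (-(RcoK i b B cfg parS (GpY i parS) U₁ ∘ₗ GcoS i b B cfg (GpY i parS) U₁ ∘ₗ DvscoKH i b B cfg U₁ ∘ₗ D2coK i b B cfg Δ2 U₁)) +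
      (-(D2coK i b B cfg Δ2 U₁ ∘ₗ DvcoKH i b B cfg U₁ ∘ₗ GcoS i b B cfg (GpY i parS) U₁ ∘ₗ RcoK i b B cfg parS (GpY i parS) U₁)) ∘ₗ
        DvscoKH i b B cfg U₁ +
      DvcoKH i b B cfg U₁ ∘ₗ
        (RcoK i b B cfg parS (GpY i parS) U₁ ∘ₗ GcoS i b B cfg (GpY i parS) U₁ ∘ₗ DvscoKH i b B cfg U₁ ∘ₗ D2coK i b B cfg Δ2 U₁ ∘ₗ
          DvcoKH i b B cfg U₁ ∘ₗ GcoS i b B cfg (GpY i parS) U₁ ∘ₗ RcoK i b B cfg parS (GpY i parS) U₁) ∘ₗ DvscoKH i b B cfg U₁ := by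
  rw [t2coK_phys_eq_sandwich i b B cfg parS Δ2 hc U₁]
  simp only [Module.End.one_eq_id, LinearMap.sub_comp, LinearMap.comp_sub, LinearMap.id_comp, LinearMap.comp_id, LinearMap.comp_neg,
    LinearMap.neg_comp, LinearMap.comp_assoc]
  abel

variable {g : B9.Geometry} {Y W' : Type}

/-- **the two-sided split at a pinned letter record** (the certificate's pins `T2 ↦ T2coK … (GpPhysY) Δ2`, `Dv ↦ DvcoKH`, `Dvstar ↦ DvscoKH` — n06-d's `hT2co12 hDvco12
hDvsco12` shapes). [cite: Balaban1985BackgroundPropagators, (3.135) p.422, p.423] -/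
theorem t2_split4_of_pins (hc : cR39 b ≠ 0) (𝔬 : Ops g B (XBK κ i) Y W' (XSK κ i)) (U₁ : B.Cfg)
    (hT2 : 𝔬.T2 U₁ = T2coK i b B cfg parS (GpPhysY i parS) Δ2 U₁) (hDv : 𝔬.Dv U₁ = DvcoKH i b B cfg U₁) (hDvs : 𝔬.Dvstar U₁ = DvscoKH i b B cfg U₁) :
    𝔬.T2 U₁ =
      D2coK i b B cfg Δ2 U₁ +
      𝔬.Dv U₁ ∘ₗ (-(RcoK i b B cfg parS (GpY i parS) U₁ ∘ₗ GcoS i b B cfg (GpY i parS) U₁ ∘ₗ DvscoKH i b B cfg U₁ ∘ₗ D2coK i b B cfg Δ2 U₁)) +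
      (-(D2coK i b B cfg Δ2 U₁ ∘ₗ DvcoKH i b B cfg U₁ ∘ₗ GcoS i b B cfg (GpY i parS) U₁ ∘ₗ RcoK i b B cfg parS (GpY i parS) U₁)) ∘ₗ 𝔬.Dvstar U₁ +
      𝔬.Dv U₁ ∘ₗ (RcoK i b B cfg parS (GpY i parS) U₁ ∘ₗ GcoS i b B cfg (GpY i parS) U₁ ∘ₗ DvscoKH i b B cfg U₁ ∘ₗ D2coK i b B cfg Δ2 U₁ ∘ₗ
          DvcoKH i b B cfg U₁ ∘ₗ GcoS i b B cfg (GpY i parS) U₁ ∘ₗ RcoK i b B cfg parS (GpY i parS) U₁) ∘ₗ 𝔬.Dvstar U₁ := by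
  rw [hT2, hDv, hDvs]
  exact t2coK_phys_eq_split4 i b B cfg parS Δ2 hc U₁

end Split

/-! ## §2 The four sup letters at the models, member-uniform constants -/

section SupLetters

variable {g : B9.Geometry} [Fintype g.Site] {R₀ : ℝ} {H₀ : Prop}
variable {i b B cfg parS Δ2} {U₁ : B.Cfg} {blkW : XSK κ i → g.Site} {blk : XBK κ i → g.Site}
  {B₀ δ₀ CP δP θ₂ δ₂ r δT σ c : ℝ} {dF : ℕ} {δ α L₀ : ℝ}

/-- ★★ **THE RESIDUAL LETTER M = Δ⁽²⁾ : 𝔠⁽²⁾ → 𝔠⁽⁰⁾ FROM THE CERTIFICATE'S `hD2sup` ALONE** ((3.137) as displayed about def-Y's free letter `Δ2`: `HasMajorant blk (D2coK … Δ2 U)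
(θ₂·(len a)⁻²·e^{−δ₂d})`), size θ₂L², rate δ_T (δ_T + αδ ≦ r ≦ δ₂). [cite: Balaban1985BackgroundPropagators, (3.137) p.423 + p.398 (remark after (3.47)); Balaban1984PropagatorsII, Lemma 2.1 (2.60) p.234] -/
theorem m_of_hD2 (hG : GeoOK g) (hF : Facts347 g R₀ H₀ dF δ α L₀) (hθ₂ : 0 ≤ θ₂) (hr : r ≤ δ₂) (hδT : δT + α * δ ≤ r)
    (hD2 : HasMajorant (g := toB6 g R₀ H₀) blk (D2coK i b B cfg Δ2 U₁) (fun (a a' : g.Site) => θ₂ * (g.len a ^ 2)⁻¹ * Real.exp (-(δ₂ * g.dist a a')))) :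
    HasMaj (cNorm R₀ H₀ blk hG.lenle 2) (cNorm R₀ H₀ blk hG.lenle 0) (D2coK i b B cfg Δ2 U₁)
      (fun a a' => θ₂ * g.L ^ 2 * Real.exp (-(δT * g.dist a a'))) :=
  maj_M hG hF hθ₂ hr hδT hD2

/-- ★★ **THE X-WORD `X₂ = −(R∘G∘D\*∘Δ⁽²⁾) : 𝔠⁽²⁾ → 𝔠_W⁽¹⁾` AT THE MODELS** from `hD2sup h31 h49` (R = c_R⁻¹(I − P)); size `A·θ₂L²·c`, A = `constA c_R⁻¹ B₀ C_P c L`. [cite: Balaban1985BackgroundPropagators, (3.135) p.422, (3.137) p.423, p.423, (3.42) p.397, (3.49) p.399; Balaban1984PropagatorsII, (2.54), (2.60)–(2.61) pp.233–234] -/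
theorem x2_of_letters_phys (hG : GeoOK g) (hF : Facts347 g R₀ H₀ dF δ α L₀) (hrow : RowSum (toB6 g R₀ H₀) σ c) (hc0 : 0 < cR39 b)
    (h31 : Thm31GpMaj blkW blk (GcoS i b B cfg (GpY i parS) U₁) (DvcoKH i b B cfg U₁) (DvscoKH i b B cfg U₁) R₀ H₀ B₀ δ₀)
    (h49 : Proj349Maj blkW blk (PcoK i b B cfg parS (GpY i parS) U₁) (DvcoKH i b B cfg U₁) (DvscoKH i b B cfg U₁) R₀ H₀ CP δP)
    (hD2 : HasMajorant (g := toB6 g R₀ H₀) blk (D2coK i b B cfg Δ2 U₁) (fun (a a' : g.Site) => θ₂ * (g.len a ^ 2)⁻¹ * Real.exp (-(δ₂ * g.dist a a'))))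
    (hB₀ : 0 ≤ B₀) (hCP : 0 ≤ CP) (hθ₂ : 0 ≤ θ₂) (hc : 0 ≤ c) (hσ : 0 ≤ σ) (hτ : 0 ≤ α * δ)
    (hr₀ : r ≤ δ₀) (hrP : r ≤ δP) (hr₂ : r ≤ δ₂) (hδT₀ : 0 ≤ δT) (hδT : δT + 2 * σ + 3 * (α * δ) ≤ r) :
    HasMaj (cNorm R₀ H₀ blk hG.lenle 2) (cNorm R₀ H₀ blkW hG.lenle 1)
      (-(RcoK i b B cfg parS (GpY i parS) U₁ ∘ₗ GcoS i b B cfg (GpY i parS) U₁ ∘ₗ DvscoKH i b B cfg U₁ ∘ₗ D2coK i b B cfg Δ2 U₁))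
      (fun a a' => constA (cR39 b)⁻¹ B₀ CP c g.L * (θ₂ * g.L ^ 2) * c * Real.exp (-(δT * g.dist a a'))) := by
  have h := maj_X2 hG hF hrow h31 h49 hD2 (rcoK_eq i b B cfg parS (GpY i parS) U₁) (inv_nonneg.mpr hc0.le) hB₀ hCP hθ₂ hc hσ hτ
    hr₀ hrP hr₂ hδT₀ hδT 1
  rw [one_smul] at h
  refine h.neg.mono fun a a' => le_of_eq ?_
  rw [abs_one, one_mul]

/-- ★★ **THE Y-WORD `Y₂ = −(Δ⁽²⁾∘D∘G∘R) : 𝔠_W⁽¹⁾ → 𝔠⁽⁰⁾` AT THE MODELS** (it eats the right neighbour's `D\*_UG₀μ`) from `hD2sup h31 h49`; size `θ₂L²·A·L·c`. [cite: Balaban1985BackgroundPropagators, (3.135) p.422, (3.137) p.423, p.423, (3.42) p.397, (3.49) p.399; Balaban1984PropagatorsII, (2.54), (2.60)–(2.61) pp.233–234] -/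
theorem y2_of_letters_phys (hG : GeoOK g) (hF : Facts347 g R₀ H₀ dF δ α L₀) (hrow : RowSum (toB6 g R₀ H₀) σ c) (hc0 : 0 < cR39 b)
    (h31 : Thm31GpMaj blkW blk (GcoS i b B cfg (GpY i parS) U₁) (DvcoKH i b B cfg U₁) (DvscoKH i b B cfg U₁) R₀ H₀ B₀ δ₀)
    (h49 : Proj349Maj blkW blk (PcoK i b B cfg parS (GpY i parS) U₁) (DvcoKH i b B cfg U₁) (DvscoKH i b B cfg U₁) R₀ H₀ CP δP)
    (hD2 : HasMajorant (g := toB6 g R₀ H₀) blk (D2coK i b B cfg Δ2 U₁) (fun (a a' : g.Site) => θ₂ * (g.len a ^ 2)⁻¹ * Real.exp (-(δ₂ * g.dist a a'))))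
    (hB₀ : 0 ≤ B₀) (hCP : 0 ≤ CP) (hθ₂ : 0 ≤ θ₂) (hc : 0 ≤ c) (hσ : 0 ≤ σ) (hτ : 0 ≤ α * δ)
    (hr₀ : r ≤ δ₀) (hrP : r ≤ δP) (hr₂ : r ≤ δ₂) (hδT₀ : 0 ≤ δT) (hδT : δT + 2 * σ + 3 * (α * δ) ≤ r) :
    HasMaj (cNorm R₀ H₀ blkW hG.lenle 1) (cNorm R₀ H₀ blk hG.lenle 0)
      (-(D2coK i b B cfg Δ2 U₁ ∘ₗ DvcoKH i b B cfg U₁ ∘ₗ GcoS i b B cfg (GpY i parS) U₁ ∘ₗ RcoK i b B cfg parS (GpY i parS) U₁))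
      (fun a a' => θ₂ * g.L ^ 2 * (constA (cR39 b)⁻¹ B₀ CP c g.L * g.L) * c * Real.exp (-(δT * g.dist a a'))) := by
  have h := maj_Y2 hG hF hrow h31 h49 hD2 (rcoK_eq i b B cfg parS (GpY i parS) U₁) (inv_nonneg.mpr hc0.le) hB₀ hCP hθ₂ hc hσ hτ
    hr₀ hrP hr₂ hδT₀ hδT 1
  rw [one_smul] at h
  refine h.neg.mono fun a a' => le_of_eq ?_
  rw [abs_one, one_mul]

/-- ★★ **THE Z-WORD `Z₂ = R∘G∘D\*∘Δ⁽²⁾∘D∘G∘R : 𝔠_W⁽¹⁾ → 𝔠_W⁽¹⁾` AT THE MODELS** from `hD2sup h31 h49`; size `A·(θ₂L²·A·L·c)·c`. [cite: Balaban1985BackgroundPropagators, (3.135) p.422, (3.137) p.423, p.423, (3.42) p.397, (3.49) p.399; Balaban1984PropagatorsII, (2.54), (2.60)–(2.61) pp.233–234] -/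
theorem z2_of_letters_phys (hG : GeoOK g) (hF : Facts347 g R₀ H₀ dF δ α L₀) (hrow : RowSum (toB6 g R₀ H₀) σ c) (hc0 : 0 < cR39 b)
    (h31 : Thm31GpMaj blkW blk (GcoS i b B cfg (GpY i parS) U₁) (DvcoKH i b B cfg U₁) (DvscoKH i b B cfg U₁) R₀ H₀ B₀ δ₀)
    (h49 : Proj349Maj blkW blk (PcoK i b B cfg parS (GpY i parS) U₁) (DvcoKH i b B cfg U₁) (DvscoKH i b B cfg U₁) R₀ H₀ CP δP)
    (hD2 : HasMajorant (g := toB6 g R₀ H₀) blk (D2coK i b B cfg Δ2 U₁) (fun (a a' : g.Site) => θ₂ * (g.len a ^ 2)⁻¹ * Real.exp (-(δ₂ * g.dist a a'))))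
    (hB₀ : 0 ≤ B₀) (hCP : 0 ≤ CP) (hθ₂ : 0 ≤ θ₂) (hc : 0 ≤ c) (hσ : 0 ≤ σ) (hτ : 0 ≤ α * δ)
    (hr₀ : r ≤ δ₀) (hrP : r ≤ δP) (hr₂ : r ≤ δ₂) (hδT₀ : 0 ≤ δT) (hδT : δT + 2 * σ + 3 * (α * δ) ≤ r) :
    HasMaj (cNorm R₀ H₀ blkW hG.lenle 1) (cNorm R₀ H₀ blkW hG.lenle 1)
      (RcoK i b B cfg parS (GpY i parS) U₁ ∘ₗ GcoS i b B cfg (GpY i parS) U₁ ∘ₗ DvscoKH i b B cfg U₁ ∘ₗ D2coK i b B cfg Δ2 U₁ ∘ₗ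
        DvcoKH i b B cfg U₁ ∘ₗ GcoS i b B cfg (GpY i parS) U₁ ∘ₗ RcoK i b B cfg parS (GpY i parS) U₁)
      (fun a a' => constA (cR39 b)⁻¹ B₀ CP c g.L * (θ₂ * g.L ^ 2 * (constA (cR39 b)⁻¹ B₀ CP c g.L * g.L) * c) * c *
        Real.exp (-(δT * g.dist a a'))) := by
  have h := maj_Z2 hG hF hrow h31 h49 hD2 (rcoK_eq i b B cfg parS (GpY i parS) U₁) (inv_nonneg.mpr hc0.le) hB₀ hCP hθ₂ hc hσ hτ
    hr₀ hrP hr₂ hδT₀ hδT 1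
  rw [one_smul] at h
  refine h.mono fun a a' => le_of_eq ?_
  rw [abs_one, one_mul]

end SupLetters

/-! ## §3 The two under-D_U words INTO the (P2′) Hölder class from ONE (3.43) member of G′∇\*_U -/

section HolderLetters

variable [Fintype (geo9K i).Site] {R₀ : ℝ} {H₀ : Prop} {bI : FBondY i → IBondY i} {dF : ℕ} {δF α L₀ σ c : ℝ}
variable (w : ℝ → ℝ) (hw0 : ∀ s, 0 ≤ w s) (hw1 : ∀ s, w s ≤ 1)

/-- ★★ **THE X-WORD INTO THE CLASS**: `X₂ = −(RG′∇\*_U∘Δ⁽²⁾) : 𝔠⁽²⁾ → bHZPG (taxiS U) w` at (P2′)'s carriers (`blkBK bI`, `blkSK (sIK bI)`), from the residual's sup letter (`hD2sup`,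
the Y-word of the engine at real weights `𝔠^{(−2)} → 𝔠⁽⁰⁾`), the (3.42)₃ sup word of G′∇\*_U (`h31`), (3.49)₁,₂ (`h49`) and ONE (3.43) member `h43` of G′∇\*_U INTO the class;
size `(B₄₃c_R⁻¹(θ₂L²)c + CTel ρ K′ K′)`, `K′ = C_PL·(B₀c_R⁻¹(θ₂L²)c)·c`, rate `ρ` (`0 ≤ ρ`, `ρ + αδ_F ≤ δ₂`, `ρ + σ ≤ δ₄₃`, `ρ + σ + αδ_F ≤ r ≤ min(δ₀, δ_P)`).  The under-D_U
letter of (3.135)'s second term with both neighbours absorbed (two-sided split); the one-sided honest `tb₂H` is §4.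
[cite: Balaban1985BackgroundPropagators, (3.135) p.422 + (3.137) p.423 + p.421 + p.423 + Thm 3.1 (3.42)–(3.43) pp.397–398 + (3.49) p.399; Balaban1984PropagatorsII, (2.51)–(2.54), (2.60)–(2.61) pp.232–234] -/
theorem x2H_pins_print_of_h43 (hG : GeoOK (geo9K i)) (hF : Facts347 (geo9K i) R₀ H₀ dF δF α L₀) (hrow : RowSum (toB6 (geo9K i) R₀ H₀) σ c)
    (hc0 : 0 < cR39 b) (hβ1 : ∀ f : FBondY i, (geomT i.D).dist (β i.hN i.D i.hk (bI f)) (blkV1 i.hN i.D f) ≤ 1)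
    (hlev : ∀ f : FBondY i, lvl i.hN i.D i.hk (bI f) = (blkV1 i.hN i.D f).1.1)
    (hcf : |i.cf| = (nKT (toKT i) : ℝ)) {U₁ : B.Cfg} (hU : ∀ ν x, UnitaryLike (cfg U₁ ν x)) {B₀ δ₀ CP δP B43 δ43 θ₂ δ₂ r ρ : ℝ}
    (h31 : Thm31GpMaj (g := geo9K i) (blkSK (κ := κ) i (sIK i bI)) (blkBK (κ := κ) i bI) (GcoS i b B cfg (GpY i parS) U₁) (DvcoKH i b B cfg U₁) (DvscoKH i b B cfg U₁) R₀ H₀ B₀ δ₀)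
    (h49 : Proj349Maj (g := geo9K i) (blkSK (κ := κ) i (sIK i bI)) (blkBK (κ := κ) i bI) (PcoK i b B cfg parS (GpY i parS) U₁) (DvcoKH i b B cfg U₁) (DvscoKH i b B cfg U₁) R₀ H₀ CP δP)
    (h43 : HasMaj (cNorm R₀ H₀ (blkBK i bI) hG.lenle 0) (bHZPG (κ := κ) i b (taxiS i B cfg U₁) (R := R₀) (H := H₀) w hw0 hw1)
      (GcoS i b B cfg (GpY i parS) U₁ ∘ₗ DvscoKH i b B cfg U₁) (fun a a' => B43 * Real.exp (-(δ43 * (geo9K i).dist a a'))))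
    (hD2 : HasMajorant (g := toB6 (geo9K i) R₀ H₀) (blkBK (κ := κ) i bI) (D2coK i b B cfg Δ2 U₁)
      (fun (a a' : (geo9K i).Site) => θ₂ * ((geo9K i).len a ^ 2)⁻¹ * Real.exp (-(δ₂ * (geo9K i).dist a a'))))
    (hB₀ : 0 ≤ B₀) (hCP : 0 ≤ CP) (hB43 : 0 ≤ B43) (hθ₂ : 0 ≤ θ₂) (hc : 0 ≤ c) (hτ : 0 ≤ α * δF)
    (hr₀ : r ≤ δ₀) (hrP : r ≤ δP) (hρ : 0 ≤ ρ) (hbud2 : ρ + α * δF ≤ δ₂) (hbud : ρ + σ + α * δF ≤ r) (hbud43 : ρ + σ ≤ δ43) :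
    HasMaj (cNorm R₀ H₀ (blkBK i bI) hG.lenle 2) (bHZPG (κ := κ) i b (taxiS i B cfg U₁) (R := R₀) (H := H₀) w hw0 hw1)
      (-(RcoK i b B cfg parS (GpY i parS) U₁ ∘ₗ GcoS i b B cfg (GpY i parS) U₁ ∘ₗ DvscoKH i b B cfg U₁ ∘ₗ D2coK i b B cfg Δ2 U₁))
      (fun a a' => (B43 * ((cR39 b)⁻¹ * (θ₂ * (geo9K i).L ^ 2)) * c +
            CTel d ℓ b ρ (CP * (geo9K i).L * (B₀ * ((cR39 b)⁻¹ * (θ₂ * (geo9K i).L ^ 2)) * c) * c)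
              (CP * (geo9K i).L * (B₀ * ((cR39 b)⁻¹ * (θ₂ * (geo9K i).L ^ 2)) * c) * c)) *
        Real.exp (-(ρ * (geo9K i).dist a a'))) := by
  have hcinv : 0 ≤ (cR39 b)⁻¹ := inv_nonneg.2 hc0.le
  have hL0 : 0 ≤ (geo9K i).L := le_trans zero_le_one hF.one_le_L
  have hR := rcoK_eq i b B cfg parS (GpY i parS) U₁
  -- the residual as the engine's Y-word: 𝔠^{(−2)} → 𝔠⁽⁰⁾, size θ₂L², rate ρ
  have hY := maj_M_R hG hF hθ₂ le_rfl hbud2 hD2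
  have h43' : HasMaj (cNormR R₀ H₀ (blkBK i bI) hG.lenle 0) (bHZPG (κ := κ) i b (taxiS i B cfg U₁) (R := R₀) (H := H₀) w hw0 hw1)
      (GcoS i b B cfg (GpY i parS) U₁ ∘ₗ DvscoKH i b B cfg U₁) (fun a a' => B43 * Real.exp (-(δ43 * (geo9K i).dist a a'))) := by
    have h := hasMaj_src_toR hG h43
    rwa [Nat.cast_zero, neg_zero] at h
  have h := hasMaj_R_GpDvs_comp_into_bHZPG i b B cfg w hw0 hw1 hG hF hrow hβ1 hlev hcf hU hB₀ hCP hB43 (mul_nonneg hθ₂ (pow_nonneg hL0 2)) hc hρ le_rfl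
    hbud hbud43 hτ hR (h31.gpDvs_cls hG hB₀ hr₀) h43' (h49.p_cls hG hCP hrP) (h49.dvP_cls hG hCP hrP) hY
  simp only [abs_of_nonneg hcinv] at h
  refine hasMaj_src_ofR hG (q := 2) ?_
  rw [Nat.cast_ofNat]
  exact h.neg.congr fun μ => rfl

/-- ★★ **THE Z-WORD INTO THE CLASS**: `Z₂ = RG′∇\*_U∘(Δ⁽²⁾∘D_UG′R) : 𝔠_W⁽¹⁾ → bHZPG (taxiS U) w` at (P2′)'s carriers, from the Y-word's sup letter at real weights (`hD2sup h31 h49`,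
`B9PerturbationMajorant2Letters.maj_Y2_R`), the (3.42)₃ sup word, (3.49)₁,₂ and ONE (3.43) member `h43` of G′∇\*_U; size `(B₄₃c_R⁻¹K_Yc + CTel ρ K′ K′)`, `K_Y = θ₂L²·A·L·c`,
`K′ = C_PL·(B₀c_R⁻¹K_Yc)·c`, rate `ρ` (`0 ≤ ρ`, `ρ + 2σ + 3αδ_F ≤ r ≤ min(δ₀, δ_P, δ₂)`, `ρ + σ ≤ δ₄₃`): the inner letter of (3.135)'s fourth term.
[cite: Balaban1985BackgroundPropagators, (3.135) p.422 + (3.137) p.423 + p.421 + p.423 + Thm 3.1 (3.42)–(3.43) pp.397–398 + (3.49) p.399; Balaban1984PropagatorsII, (2.51)–(2.54), (2.60)–(2.61) pp.232–234] -/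
theorem z2H_pins_print_of_h43 (hG : GeoOK (geo9K i)) (hF : Facts347 (geo9K i) R₀ H₀ dF δF α L₀) (hrow : RowSum (toB6 (geo9K i) R₀ H₀) σ c)
    (hc0 : 0 < cR39 b) (hβ1 : ∀ f : FBondY i, (geomT i.D).dist (β i.hN i.D i.hk (bI f)) (blkV1 i.hN i.D f) ≤ 1)
    (hlev : ∀ f : FBondY i, lvl i.hN i.D i.hk (bI f) = (blkV1 i.hN i.D f).1.1)
    (hcf : |i.cf| = (nKT (toKT i) : ℝ)) {U₁ : B.Cfg} (hU : ∀ ν x, UnitaryLike (cfg U₁ ν x)) {B₀ δ₀ CP δP B43 δ43 θ₂ δ₂ r ρ : ℝ}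
    (h31 : Thm31GpMaj (g := geo9K i) (blkSK (κ := κ) i (sIK i bI)) (blkBK (κ := κ) i bI) (GcoS i b B cfg (GpY i parS) U₁) (DvcoKH i b B cfg U₁) (DvscoKH i b B cfg U₁) R₀ H₀ B₀ δ₀)
    (h49 : Proj349Maj (g := geo9K i) (blkSK (κ := κ) i (sIK i bI)) (blkBK (κ := κ) i bI) (PcoK i b B cfg parS (GpY i parS) U₁) (DvcoKH i b B cfg U₁) (DvscoKH i b B cfg U₁) R₀ H₀ CP δP)
    (h43 : HasMaj (cNorm R₀ H₀ (blkBK i bI) hG.lenle 0) (bHZPG (κ := κ) i b (taxiS i B cfg U₁) (R := R₀) (H := H₀) w hw0 hw1)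
      (GcoS i b B cfg (GpY i parS) U₁ ∘ₗ DvscoKH i b B cfg U₁) (fun a a' => B43 * Real.exp (-(δ43 * (geo9K i).dist a a'))))
    (hD2 : HasMajorant (g := toB6 (geo9K i) R₀ H₀) (blkBK (κ := κ) i bI) (D2coK i b B cfg Δ2 U₁)
      (fun (a a' : (geo9K i).Site) => θ₂ * ((geo9K i).len a ^ 2)⁻¹ * Real.exp (-(δ₂ * (geo9K i).dist a a'))))
    (hB₀ : 0 ≤ B₀) (hCP : 0 ≤ CP) (hB43 : 0 ≤ B43) (hθ₂ : 0 ≤ θ₂) (hc : 0 ≤ c) (hσ : 0 ≤ σ) (hτ : 0 ≤ α * δF)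
    (hr₀ : r ≤ δ₀) (hrP : r ≤ δP) (hr₂ : r ≤ δ₂) (hρ : 0 ≤ ρ) (hbud : ρ + 2 * σ + 3 * (α * δF) ≤ r) (hbud43 : ρ + σ ≤ δ43) :
    HasMaj (cNorm R₀ H₀ (blkSK i (sIK i bI)) hG.lenle 1) (bHZPG (κ := κ) i b (taxiS i B cfg U₁) (R := R₀) (H := H₀) w hw0 hw1)
      (RcoK i b B cfg parS (GpY i parS) U₁ ∘ₗ GcoS i b B cfg (GpY i parS) U₁ ∘ₗ DvscoKH i b B cfg U₁ ∘ₗ D2coK i b B cfg Δ2 U₁ ∘ₗ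
        DvcoKH i b B cfg U₁ ∘ₗ GcoS i b B cfg (GpY i parS) U₁ ∘ₗ RcoK i b B cfg parS (GpY i parS) U₁)
      (fun a a' => (B43 * ((cR39 b)⁻¹ * (θ₂ * (geo9K i).L ^ 2 * (constA (cR39 b)⁻¹ B₀ CP c (geo9K i).L * (geo9K i).L) * c)) * c +
            CTel d ℓ b ρ (CP * (geo9K i).L * (B₀ * ((cR39 b)⁻¹ * (θ₂ * (geo9K i).L ^ 2 * (constA (cR39 b)⁻¹ B₀ CP c (geo9K i).L * (geo9K i).L) * c)) * c) * c)
              (CP * (geo9K i).L * (B₀ * ((cR39 b)⁻¹ * (θ₂ * (geo9K i).L ^ 2 * (constA (cR39 b)⁻¹ B₀ CP c (geo9K i).L * (geo9K i).L) * c)) * c) * c)) *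
        Real.exp (-(ρ * (geo9K i).dist a a'))) := by
  have hcinv : 0 ≤ (cR39 b)⁻¹ := inv_nonneg.2 hc0.le
  have hL0 : 0 ≤ (geo9K i).L := le_trans zero_le_one hF.one_le_L
  have hA : 0 ≤ constA (cR39 b)⁻¹ B₀ CP c (geo9K i).L := B9PerturbationMajorantAlgebra.constA_nonneg hcinv hB₀ hCP hc
  have hR := rcoK_eq i b B cfg parS (GpY i parS) U₁
  -- the Y-word at real weights (engine input shape): 𝔠_W^{(−1)} → 𝔠⁽⁰⁾, rate ρ
  have hY := maj_Y2_R hG hF hrow h31 h49 hD2 hR hcinv hB₀ hCP hθ₂ hc hσ hτ hr₀ hrP hr₂ hρ hbud 1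
  rw [one_smul] at hY
  simp only [abs_one, one_mul] at hY
  have h43' : HasMaj (cNormR R₀ H₀ (blkBK i bI) hG.lenle 0) (bHZPG (κ := κ) i b (taxiS i B cfg U₁) (R := R₀) (H := H₀) w hw0 hw1)
      (GcoS i b B cfg (GpY i parS) U₁ ∘ₗ DvscoKH i b B cfg U₁) (fun a a' => B43 * Real.exp (-(δ43 * (geo9K i).dist a a'))) := by
    have h := hasMaj_src_toR hG h43
    rwa [Nat.cast_zero, neg_zero] at h
  have h := hasMaj_R_GpDvs_comp_into_bHZPG i b B cfg w hw0 hw1 hG hF hrow hβ1 hlev hcf hU hB₀ hCP hB43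
    (mul_nonneg (mul_nonneg (mul_nonneg hθ₂ (pow_nonneg hL0 2)) (mul_nonneg hA hL0)) hc) hc hρ le_rfl
    (show ρ + σ + α * δF ≤ r by linarith) hbud43 hτ hR (h31.gpDvs_cls hG hB₀ hr₀) h43' (h49.p_cls hG hCP hrP) (h49.dvP_cls hG hCP hrP) hY
  simp only [abs_of_nonneg hcinv] at h
  refine hasMaj_src_ofR hG (q := 1) ?_
  rw [Nat.cast_one]
  exact h.congr fun μ => rfl

end HolderLetters

/-! ## §4 The ONE-SIDED letters T_a₂, T_b₂ of the left split FROM A REGULAR SOURCE at the models: the honest form of `hta₂` and of `Letters3131H.tb₂H` -/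

section OneSidedFromSource

omit [CompleteSpace 𝔸] [FiniteDimensional ℝ 𝔸] in
/-- `restrictScalars` through composition (definitional). [cite: Balaban1985BackgroundPropagators, (3.135) p.422, dictionary] -/
private theorem rS_comp {T₁ T₂ T₃ : Type} (f : (T₂ → 𝔸) →ₗ[ℂ] (T₃ → 𝔸)) (g : (T₁ → 𝔸) →ₗ[ℂ] (T₂ → 𝔸)) :
    (f ∘ₗ g).restrictScalars ℝ = f.restrictScalars ℝ ∘ₗ g.restrictScalars ℝ := rfl

omit [CompleteSpace 𝔸] [FiniteDimensional ℝ 𝔸] in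
/-- `restrictScalars` through differences (definitional). [cite: Balaban1985BackgroundPropagators, (3.135) p.422, dictionary] -/
private theorem rS_sub {T₁ T₂ : Type} (f g : (T₁ → 𝔸) →ₗ[ℂ] (T₂ → 𝔸)) :
    (f - g).restrictScalars ℝ = f.restrictScalars ℝ - g.restrictScalars ℝ := rfl

omit [CompleteSpace 𝔸] [FiniteDimensional ℝ 𝔸] in
/-- `restrictScalars` of the identity (definitional). [cite: Balaban1985BackgroundPropagators, (3.135) p.422, dictionary] -/
private theorem rS_id {T₁ : Type} : (LinearMap.id : (T₁ → 𝔸) →ₗ[ℂ] (T₁ → 𝔸)).restrictScalars ℝ = LinearMap.id := rfl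

omit [CompleteSpace 𝔸] [FiniteDimensional ℝ 𝔸] in
/-- `restrictScalars` of a real multiple written as a complex scalar. [cite: Balaban1985BackgroundPropagators, (3.25) p.394, dictionary] -/
private theorem rS_real_smul {T₁ T₂ : Type} (r : ℝ) (f : (T₁ → 𝔸) →ₗ[ℂ] (T₂ → 𝔸)) :
    ((r : ℂ) • f).restrictScalars ℝ = r • f.restrictScalars ℝ := by
  ext x t
  simp only [LinearMap.restrictScalars_apply, LinearMap.smul_apply, Pi.smul_apply, Complex.coe_smul]

/-- ★ **T_a₂ AT THE PRINT-UNITS LETTER**: `Ta2LcoK … (GpPhysY) Δ2 U = D2coK Δ2 U ∘ (1 − DvcoKH ∘ GcoS(GpY) ∘ RcoK(GpY) ∘ DvscoKH)` — T_a₂ = Δ⁽²⁾(1 − D_UG′RD\*_U) in coordinates,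
no units factor (dag-n06-w8's gauge-projection identity inside `t2coK_phys_eq_sandwich`, isolated). [cite: Balaban1985BackgroundPropagators, (3.135) p.422, (3.119) p.419, (3.25) p.394] -/
theorem ta2LcoK_phys_eq_comp (hc : cR39 b ≠ 0) (U₁ : B.Cfg) :
    Ta2LcoK i b B cfg parS (GpPhysY i parS) Δ2 U₁ =
      D2coK i b B cfg Δ2 U₁ ∘ₗ (LinearMap.id - DvcoKH i b B cfg U₁ ∘ₗ GcoS i b B cfg (GpY i parS) U₁ ∘ₗ RcoK i b B cfg parS (GpY i parS) U₁ ∘ₗ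
        DvscoKH i b B cfg U₁) := by
  have hη : etaS i ^ 2 ≠ 0 := pow_ne_zero 2 (etaS_pos i).ne'
  have hπ : coordOpK b (fun _ : Fin (d + 1) => (gaugePiY i parS (GpPhysY i parS) (cfg U₁)).restrictScalars ℝ) =
      1 - DvcoKH i b B cfg U₁ ∘ₗ GcoS i b B cfg (GpY i parS) U₁ ∘ₗ RcoK i b B cfg parS (GpY i parS) U₁ ∘ₗ DvscoKH i b B cfg U₁ := by
    rw [gaugePiY, RY_GpPhysY, GpPhysY_apply, DvcoKH, DvscoKH, GcoS, RcoK]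
    simp only [rS_sub, rS_id, rS_comp, rS_real_smul, LinearMap.comp_smul, LinearMap.smul_comp, smul_smul, coordOpK_const_sub, coordOpK_id,
      coordOpK_smul, coordOpK_const_comp_coordOpKH_const, coordOpKH_const_comp_coordOpKH_const, coordOpKH_eq_coordOpK, Module.End.one_eq_id]
    rw [show (cR39 b)⁻¹ * (etaS i ^ 2 * cR39 b) = etaS i ^ 2 by field_simp]
  rw [Ta2LcoK, Ta2LY, rS_comp, coordOpK_const_comp, hπ, D2coK]
  simp only [LinearMap.smul_comp, Module.End.one_eq_id]

variable {g : B9.Geometry} [Fintype g.Site] {R₀ : ℝ} {H₀ : Prop}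

/-- ★★★ **THE HONEST `hta₂`: T_a₂ AT THE MODELS FROM A REGULAR SOURCE CLASS.**  For any source block norm `b₁` on the bond carrier carrying (i) a sup reading at dimension 2
(`hsrc : id : b₁ → 𝔠^{(−2)}`) and (ii) the (3.44) member of the sandwich at dimension 2 (`h44 : DvcoKH ∘ GcoS(GpY) ∘ DvscoKH : b₁ → 𝔠^{(−2)}` — the certificate's `h44G` species
read at the state's dimension): `Ta2LcoK … (GpPhysY) Δ2 U : b₁ → cNorm blk 0` with the member-uniform size `θ₂L²·(C_s + c_R⁻¹C₄₄ + c_R⁻¹·B₀L·C_PL²·c·C_s·c)·c`, rate δ_T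
(δ_T + 3σ + 3αδ ≤ r ≤ min(δ₀, δ_P, δ₂)), from `hD2sup h31 h49`.  With `b₁` = the state class of the (3.138) step (a G₀-output class) both readings are Theorem 3.3's;
with `b₁ = cNorm blk 2` reading (ii) does not exist (U8). [cite: Balaban1985BackgroundPropagators, (3.135) p.422, (3.137) p.423, (3.44) p.398, (3.42) p.397, (3.49) p.399, p.421, p.423; Balaban1984PropagatorsII, (2.54), (2.60)–(2.61) pp.233–234] -/
theorem ta2_pins_of_h44 (hG : GeoOK g) {dF : ℕ} {δ α L₀ σ c : ℝ} (hF : Facts347 g R₀ H₀ dF δ α L₀) (hrow : RowSum (toB6 g R₀ H₀) σ c) (hc0 : 0 < cR39 b)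
    {U₁ : B.Cfg} {blkW : XSK κ i → g.Site} {blk : XBK κ i → g.Site} {b₁ : BlockNorm (toB6 g R₀ H₀) (XBK κ i → ℝ)} {B₀ δ₀ CP δP θ₂ δ₂ r δT Cs C44 : ℝ}
    (h31 : Thm31GpMaj blkW blk (GcoS i b B cfg (GpY i parS) U₁) (DvcoKH i b B cfg U₁) (DvscoKH i b B cfg U₁) R₀ H₀ B₀ δ₀)
    (h49 : Proj349Maj blkW blk (PcoK i b B cfg parS (GpY i parS) U₁) (DvcoKH i b B cfg U₁) (DvscoKH i b B cfg U₁) R₀ H₀ CP δP)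
    (hD2 : HasMajorant (g := toB6 g R₀ H₀) blk (D2coK i b B cfg Δ2 U₁) (fun (a a' : g.Site) => θ₂ * (g.len a ^ 2)⁻¹ * Real.exp (-(δ₂ * g.dist a a'))))
    (hsrc : HasMaj b₁ (cNormR R₀ H₀ blk hG.lenle (-2)) LinearMap.id (fun a a' => Cs * Real.exp (-(r * g.dist a a'))))
    (h44 : HasMaj b₁ (cNormR R₀ H₀ blk hG.lenle (-2)) (DvcoKH i b B cfg U₁ ∘ₗ GcoS i b B cfg (GpY i parS) U₁ ∘ₗ DvscoKH i b B cfg U₁)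
      (fun a a' => C44 * Real.exp (-(r * g.dist a a'))))
    (hB₀ : 0 ≤ B₀) (hCP : 0 ≤ CP) (hθ₂ : 0 ≤ θ₂) (hCs : 0 ≤ Cs) (hC44 : 0 ≤ C44) (hc : 0 ≤ c) (hσ : 0 ≤ σ) (hτ : 0 ≤ α * δ)
    (hr₀ : r ≤ δ₀) (hrP : r ≤ δP) (hr₂ : r ≤ δ₂) (hδT₀ : 0 ≤ δT) (hδT : δT + 3 * σ + 3 * (α * δ) ≤ r) :
    HasMaj b₁ (cNorm R₀ H₀ blk hG.lenle 0) (Ta2LcoK i b B cfg parS (GpPhysY i parS) Δ2 U₁)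
      (fun a a' => θ₂ * g.L ^ 2 * (Cs + (cR39 b)⁻¹ * C44 + (cR39 b)⁻¹ * (B₀ * g.L * (CP * g.L ^ 2) * c * Cs * c)) * c * Real.exp (-(δT * g.dist a a'))) := by
  have hcinv : 0 ≤ (cR39 b)⁻¹ := inv_nonneg.2 hc0.le
  have h := maj_ta2_of_src hG hF hrow h31 h49 hD2 (rcoK_eq i b B cfg parS (GpY i parS) U₁) hsrc h44 hB₀ hCP hθ₂ hCs hC44 hc hσ hτ hr₀ hrP hr₂ hδT₀ hδT
  simp only [abs_of_nonneg hcinv] at h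
  refine hasMaj_tgt_ofR hG (p := 0) ?_
  rw [Nat.cast_zero, neg_zero]
  exact h.congr fun μ => by rw [ta2LcoK_phys_eq_comp i b B cfg parS Δ2 hc0.ne']

end OneSidedFromSource

section Tb2FromSource

variable [Fintype (geo9K i).Site] {R₀ : ℝ} {H₀ : Prop} {bI : FBondY i → IBondY i} {dF : ℕ} {δF α L₀ σ c : ℝ}
variable (w : ℝ → ℝ) (hw0 : ∀ s, 0 ≤ w s) (hw1 : ∀ s, w s ≤ 1)

/-- ★★★ **THE HONEST `Letters3131H.tb₂H`: T_b₂ INTO THE (P2′) CLASS FROM A REGULAR SOURCE.**  `Tb2LcoKH … (GpPhysY) Δ2 U : b₁ → bHZPG (taxiS U) w` along `T_b₂ = −(RG′∇\*_U)∘T_a₂`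
(`tb2LcoKH_phys_eq_compTa2`), the Y-word of the g25 engine being T_a₂ ON `b₁` (§4 `ta2_pins_of_h44`, print's (3.44) instead of the raw-class display `hta₂`), from `h43` (ONE (3.43)
member of G′∇\*_U), `h31 h49 hD2sup` and the two source readings; size `(B₄₃c_R⁻¹K_T c + CTel ρ K′ K′)`, `K_T` = §4's size at rate ρ, `K′ = C_PL·(B₀c_R⁻¹K_T c)·c`, rate ρ
(0 ≤ ρ, ρ + 3σ + 3αδ_F ≤ r ≤ min(δ₀, δ_P, δ₂), ρ + σ ≤ δ₄₃). [cite: Balaban1985BackgroundPropagators, (3.135) p.422 + (3.137) p.423 + (3.44) p.398 + p.421 + Thm 3.1 (3.42)–(3.43) pp.397–398 + (3.49) p.399; Balaban1984PropagatorsII, (2.51)–(2.54), (2.60)–(2.61) pp.232–234] -/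
theorem tb₂H_pins_of_h43_of_src (hG : GeoOK (geo9K i)) (hF : Facts347 (geo9K i) R₀ H₀ dF δF α L₀) (hrow : RowSum (toB6 (geo9K i) R₀ H₀) σ c)
    (hc0 : 0 < cR39 b) (hβ1 : ∀ f : FBondY i, (geomT i.D).dist (β i.hN i.D i.hk (bI f)) (blkV1 i.hN i.D f) ≤ 1)
    (hlev : ∀ f : FBondY i, lvl i.hN i.D i.hk (bI f) = (blkV1 i.hN i.D f).1.1)
    (hcf : |i.cf| = (nKT (toKT i) : ℝ)) {U₁ : B.Cfg} (hU : ∀ ν x, UnitaryLike (cfg U₁ ν x))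
    {b₁ : BlockNorm (toB6 (geo9K i) R₀ H₀) (XBK κ i → ℝ)} {B₀ δ₀ CP δP B43 δ43 θ₂ δ₂ r ρ Cs C44 : ℝ}
    (h31 : Thm31GpMaj (g := geo9K i) (blkSK (κ := κ) i (sIK i bI)) (blkBK (κ := κ) i bI) (GcoS i b B cfg (GpY i parS) U₁) (DvcoKH i b B cfg U₁) (DvscoKH i b B cfg U₁) R₀ H₀ B₀ δ₀)
    (h49 : Proj349Maj (g := geo9K i) (blkSK (κ := κ) i (sIK i bI)) (blkBK (κ := κ) i bI) (PcoK i b B cfg parS (GpY i parS) U₁) (DvcoKH i b B cfg U₁) (DvscoKH i b B cfg U₁) R₀ H₀ CP δP)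
    (h43 : HasMaj (cNorm R₀ H₀ (blkBK i bI) hG.lenle 0) (bHZPG (κ := κ) i b (taxiS i B cfg U₁) (R := R₀) (H := H₀) w hw0 hw1)
      (GcoS i b B cfg (GpY i parS) U₁ ∘ₗ DvscoKH i b B cfg U₁) (fun a a' => B43 * Real.exp (-(δ43 * (geo9K i).dist a a'))))
    (hD2 : HasMajorant (g := toB6 (geo9K i) R₀ H₀) (blkBK (κ := κ) i bI) (D2coK i b B cfg Δ2 U₁)
      (fun (a a' : (geo9K i).Site) => θ₂ * ((geo9K i).len a ^ 2)⁻¹ * Real.exp (-(δ₂ * (geo9K i).dist a a'))))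
    (hsrc : HasMaj b₁ (cNormR R₀ H₀ (blkBK i bI) hG.lenle (-2)) LinearMap.id (fun a a' => Cs * Real.exp (-(r * (geo9K i).dist a a'))))
    (h44 : HasMaj b₁ (cNormR R₀ H₀ (blkBK i bI) hG.lenle (-2)) (DvcoKH i b B cfg U₁ ∘ₗ GcoS i b B cfg (GpY i parS) U₁ ∘ₗ DvscoKH i b B cfg U₁)
      (fun a a' => C44 * Real.exp (-(r * (geo9K i).dist a a'))))
    (hB₀ : 0 ≤ B₀) (hCP : 0 ≤ CP) (hB43 : 0 ≤ B43) (hθ₂ : 0 ≤ θ₂) (hCs : 0 ≤ Cs) (hC44 : 0 ≤ C44) (hc : 0 ≤ c) (hσ : 0 ≤ σ) (hτ : 0 ≤ α * δF)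
    (hr₀ : r ≤ δ₀) (hrP : r ≤ δP) (hr₂ : r ≤ δ₂) (hρ : 0 ≤ ρ) (hbud : ρ + 3 * σ + 3 * (α * δF) ≤ r) (hbud43 : ρ + σ ≤ δ43) :
    HasMaj b₁ (bHZPG (κ := κ) i b (taxiS i B cfg U₁) (R := R₀) (H := H₀) w hw0 hw1) (Tb2LcoKH i b B cfg parS (GpPhysY i parS) Δ2 U₁)
      (fun a a' => (B43 * ((cR39 b)⁻¹ *
              (θ₂ * (geo9K i).L ^ 2 * (Cs + (cR39 b)⁻¹ * C44 + (cR39 b)⁻¹ * (B₀ * (geo9K i).L * (CP * (geo9K i).L ^ 2) * c * Cs * c)) * c)) * c +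
            CTel d ℓ b ρ
              (CP * (geo9K i).L * (B₀ * ((cR39 b)⁻¹ *
                (θ₂ * (geo9K i).L ^ 2 * (Cs + (cR39 b)⁻¹ * C44 + (cR39 b)⁻¹ * (B₀ * (geo9K i).L * (CP * (geo9K i).L ^ 2) * c * Cs * c)) * c)) * c) * c)
              (CP * (geo9K i).L * (B₀ * ((cR39 b)⁻¹ *
                (θ₂ * (geo9K i).L ^ 2 * (Cs + (cR39 b)⁻¹ * C44 + (cR39 b)⁻¹ * (B₀ * (geo9K i).L * (CP * (geo9K i).L ^ 2) * c * Cs * c)) * c)) * c) * c)) *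
        Real.exp (-(ρ * (geo9K i).dist a a'))) := by
  have hcinv : 0 ≤ (cR39 b)⁻¹ := inv_nonneg.2 hc0.le
  have hL0 : 0 ≤ (geo9K i).L := le_trans zero_le_one hF.one_le_L
  have hR := rcoK_eq i b B cfg parS (GpY i parS) U₁
  -- the Y-word: T_a₂ on b₁ at the real-weight target 𝔠⁽⁰⁾, rate ρ
  have hY₀ := maj_ta2_of_src hG hF hrow h31 h49 hD2 hR hsrc h44 hB₀ hCP hθ₂ hCs hC44 hc hσ hτ hr₀ hrP hr₂ hρ hbud
  simp only [abs_of_nonneg hcinv] at hY₀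
  have hY := hY₀.congr (T' := Ta2LcoK i b B cfg parS (GpPhysY i parS) Δ2 U₁) fun μ => by rw [ta2LcoK_phys_eq_comp i b B cfg parS Δ2 hc0.ne']
  have hK : 0 ≤ θ₂ * (geo9K i).L ^ 2 * (Cs + (cR39 b)⁻¹ * C44 + (cR39 b)⁻¹ * (B₀ * (geo9K i).L * (CP * (geo9K i).L ^ 2) * c * Cs * c)) * c := by
    positivity
  have h43' : HasMaj (cNormR R₀ H₀ (blkBK i bI) hG.lenle 0) (bHZPG (κ := κ) i b (taxiS i B cfg U₁) (R := R₀) (H := H₀) w hw0 hw1)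
      (GcoS i b B cfg (GpY i parS) U₁ ∘ₗ DvscoKH i b B cfg U₁) (fun a a' => B43 * Real.exp (-(δ43 * (geo9K i).dist a a'))) := by
    have h := hasMaj_src_toR hG h43
    rwa [Nat.cast_zero, neg_zero] at h
  have h := hasMaj_R_GpDvs_comp_into_bHZPG i b B cfg w hw0 hw1 hG hF hrow hβ1 hlev hcf hU hB₀ hCP hB43 hK hc hρ le_rfl (by linarith) hbud43 hτ hR
    (h31.gpDvs_cls hG hB₀ hr₀) h43' (h49.p_cls hG hCP hrP) (h49.dvP_cls hG hCP hrP) hY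
  simp only [abs_of_nonneg hcinv] at h
  exact h.neg.congr fun μ => by rw [tb2LcoKH_phys_eq_compTa2 i b B cfg parS hc0.ne']

end Tb2FromSource

end Literature.MathematicalPhysics.QuantumFieldTheory.Balaban1983to89.B9Thm313WholeDelta2LettersAtPinsPrint

end
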